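import Summits.ResolutionOfSingularities.ResolutionOfSingularities.Theorems.HilbertSamuelEliminationSigmaMaxModificationsCorridor3TameSmallPrimes
import Mathlib.RingTheory.Ideal.UFD
import Mathlib.RingTheory.Ideal.MinimalPrime.Noetherian
import HarnessLib

/-!
# `SigmaMaxModificationsCorridor3` (stmt-19249), line `tame_wild`: a brick of the QUADRIC GAP —
# radical height-one ideals of a UFD are principal
# (the hypothesis `hgap` of `…Corridor3TameThreeOfQuadricGap.lean`)

[OURS · L1 W4.2] The quadric gap — a non-regular point `y` of a reduced finite-type `k`-scheme of dimension
`≤ 3` with `H^3_Y(y) ≤ q := hypersurfaceHF 2` has `H^3_Y(y) = q` — makes the registered `stub_tameNu3` vacuous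
for `p ≤ 3` (`tameNu3_of_prime_le_three_of_quadricGap`, landed) and is the "no singular value strictly below
`hypersurfaceHF 2`" input of `nuMod_dim_le_three_of_isMin_singular_value` (p461590). Its paper proof: STEP 1
`H(1) ≤ 4` at a singular point forces `ψ = dim =: d` and `emb.dim = d + 1` (landed: `…TameWildValueAtOne`,
p462480); STEP 2 a regular presentation `R ↠ 𝒪_{Y,y}` with `dim R = emb.dim = d + 1`; STEP 3 (THIS FILE) the
kernel — radical, all minimal primes of height one — is PRINCIPAL, so `𝒪_{Y,y} = R/(g)` is a hypersurface;
STEP 4 `H^{(0)}(R/(g)) = hypersurfaceHFe (d+1) (ord g)` (helper H1′) and its `(3-d)`-fold sums (H1″, p460752),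
whence `ord g = 2`.

* `eq_span_prod_of_isRadical_of_height_one` / `isPrincipal_of_isRadical_of_height_one` (ring level): in a
  Noetherian UFD — e.g. a regular local ring, `IsRegularLocalRing.uniqueFactorizationMonoid` (Auslander–
  Buchsbaum, in the tree) — a radical ideal all of whose minimal primes have height one is principal,
  generated by the product of prime generators of its (finitely many) minimal primes
  (`UniqueFactorizationMonoid.isPrincipal_of_height_eq_one` + prime avoidance of the other generators by
  minimality + `I = ⋂ P` for radical `I`).

Remaining for the gap (next worker): STEP 2 (cut a presentation by `𝒪_{𝔸ⁿ,y}` down along kernel elements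
outside `𝔪²`, `IsRegularLocalRing.quotient_span_singleton`) with the height bookkeeping
`ht P = dim R - dim R/P = 1` (`isCatenaryRing_of_isRegularLocalRing`), and the assembly.
NOT a statement of any manuscript. [cite: CossartJannsenSaito2020, Def. 2.28, Lemma 2.23, Rem. 6.29]
-/

set_option linter.dupNamespace false -- mandated namespace of this single-conjunct summit

noncomputable section

open CategoryTheory AlgebraicGeometry TopologicalSpace Topology IsLocalRing
open Literature.AlgebraicGeometry.Resolution Literature.RingTheory.HilbertSamuel

namespace Summit.ResolutionOfSingularities.ResolutionOfSingularities.Theorems.SigmaMaxModificationsCorridor3.TameWild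

/-! ## Step 3: radical ideals with height-one minimal primes in a UFD are principal -/

section UFD

variable {R : Type*} [CommRing R] [IsDomain R] [IsNoetherianRing R] [UniqueFactorizationMonoid R]

/-- In a Noetherian UFD, **a radical ideal all of whose minimal primes have height one is generated by the
product of prime generators of its (finitely many) minimal primes.** Each minimal prime is principal
(`UniqueFactorizationMonoid.isPrincipal_of_height_eq_one`); an element of every `(p_P)` is divisible by the
product (distinct minimal primes give non-dividing generators); and `I = ⋂ P` as `I` is radical. [folklore] -/
theorem eq_span_prod_of_isRadical_of_height_one {I : Ideal R} (hI : I.IsRadical)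
    (hht : ∀ P ∈ I.minimalPrimes, P.height = 1) :
    ∃ (S : Finset (Ideal R)) (g : Ideal R → R), (↑S : Set (Ideal R)) = I.minimalPrimes ∧
      (∀ P ∈ S, P = Ideal.span {g P} ∧ Prime (g P)) ∧ I = Ideal.span {∏ P ∈ S, g P} := by
  classical
  have hfin : I.minimalPrimes.Finite := Ideal.finite_minimalPrimes_of_isNoetherianRing R I
  set S : Finset (Ideal R) := hfin.toFinset with hS
  have hSmem : ∀ P, P ∈ S ↔ P ∈ I.minimalPrimes := fun P => by simp [hS]
  -- prime generators of the minimal primes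
  have hgen : ∀ P ∈ S, ∃ p : R, P = Ideal.span {p} ∧ Prime p := by
    intro P hP
    have hPmin := (hSmem P).mp hP
    haveI : P.IsPrime := hPmin.1.1
    have hP1 := hht P hPmin
    have hPne : P ≠ ⊥ := P.ne_bot_of_height_eq_one hP1
    obtain ⟨x, hxmem, hxp⟩ := Ideal.IsPrime.exists_mem_prime_of_ne_bot ‹_› hPne
    exact ⟨x, P.eq_span_singleton_of_height_eq_one hP1 hxmem hxp, hxp⟩
  choose! g hg using hgen
  refine ⟨S, g, by simp [hS], hg, ?_⟩
  -- divisibility by the product, by induction on sub-finsets of `S`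
  have hdvd : ∀ (T : Finset (Ideal R)), T ⊆ S → ∀ x : R, (∀ P ∈ T, g P ∣ x) → (∏ P ∈ T, g P) ∣ x := by
    intro T
    induction T using Finset.induction_on with
    | empty => intro _ x _; simp
    | @insert P T hPT ih =>
      intro hTS x hx
      rw [Finset.prod_insert hPT]
      have hPS : P ∈ S := hTS (Finset.mem_insert_self P T)
      have hT : T ⊆ S := fun Q hQ => hTS (Finset.mem_insert_of_mem hQ)
      obtain ⟨y, rfl⟩ := ih hT x fun Q hQ => hx Q (Finset.mem_insert_of_mem hQ)
      have hp : Prime (g P) := (hg P hPS).2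
      have hpx : g P ∣ (∏ Q ∈ T, g Q) * y := hx P (Finset.mem_insert_self P T)
      -- `g P` divides no `g Q`, `Q ∈ T`: otherwise `Q ≤ P`, so `Q = P` by minimality, but `P ∉ T`
      have hndvd : ¬ g P ∣ ∏ Q ∈ T, g Q := by
        intro h
        obtain ⟨Q, hQT, hQ⟩ := (hp.dvd_finsetProd_iff _).mp h
        have hQS : Q ∈ S := hT hQT
        have hQle : Q ≤ P := by
          rw [(hg Q hQS).1, (hg P hPS).1, Ideal.span_singleton_le_span_singleton]
          exact hQ
        have hPmin := (hSmem P).mp hPS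
        have hQmin := (hSmem Q).mp hQS
        have hQP : Q = P := le_antisymm hQle (hPmin.2 ⟨hQmin.1.1, hQmin.1.2⟩ hQle)
        exact hPT (hQP ▸ hQT)
      obtain ⟨z, rfl⟩ := (hp.dvd_or_dvd hpx).resolve_left hndvd
      exact ⟨z, by ring⟩
  apply le_antisymm
  · intro x hx
    rw [Ideal.mem_span_singleton]
    refine hdvd S subset_rfl x fun P hP => ?_
    have hxP : x ∈ P := ((hSmem P).mp hP).1.2 hx
    rw [(hg P hP).1, Ideal.mem_span_singleton] at hxP
    exact hxP
  · rw [Ideal.span_singleton_le_iff_mem, ← hI.radical, ← Ideal.sInf_minimalPrimes, Ideal.mem_sInf]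
    intro P hP
    have hPS : P ∈ S := (hSmem P).mpr hP
    haveI : P.IsPrime := hP.1.1
    have hgP : g P ∈ P :=
      (Ideal.span_singleton_le_iff_mem (I := P)).mp (le_of_eq (hg P hPS).1.symm)
    obtain ⟨c, hc⟩ := Finset.dvd_prod_of_mem g hPS
    rw [hc]
    exact P.mul_mem_right c hgP

/-- Hence such an ideal is principal. [folklore] -/
theorem isPrincipal_of_isRadical_of_height_one {I : Ideal R} (hI : I.IsRadical)
    (hht : ∀ P ∈ I.minimalPrimes, P.height = 1) : I.IsPrincipal := by
  obtain ⟨S, g, -, -, hI'⟩ := eq_span_prod_of_isRadical_of_height_one (I := I) hI hht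
  exact ⟨∏ P ∈ S, g P, hI'⟩

end UFD

end Summit.ResolutionOfSingularities.ResolutionOfSingularities.Theorems.SigmaMaxModificationsCorridor3.TameWild

end
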